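import Summits.CriticalPhenomena.PercolationContinuityZ3.Theorems.Transplant.SkelFrmBChoiceCreep2
import HarnessLib

/-!
# N2 (frames-only node `SamePDropOfSkeletonFrm₁`, OPEN) — (ζ″) under (R-44)/(R-45): THE V HABITAT ROW FOR THE x-CORRIDOR (rows, axis 1):
# **`habX_box_V : rdHi₁ lo hi ≤ cRvW 0 + 5·s₁ + 1`** for any frame box whose row top is at most the phase boxes' top
# `A₁ + (m₁+1)R′ + m₂R′ + R′ + L` (p5-g16's `mem_kgCorrSched_prism_cases`: run / across-parking / along-parking rows, `L = ⌊3nℓ/U⌋ + 1`) —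
# the TIGHT certified forward reach of the x-steps on the habitat's axis 1, i.e. the (C)-side discharge of hp-8 g42/g43's
# `PCells2V.mem_habΩV_of_footprint (h4 : σ·(ψ g ⊥ − cenS⊥) ≤ hF − 1)` at x-steps with the AFFINE room `hF 0 := c 0 + 5·s₁ + 2` (SkelFrmBChoiceRoomV);
# pure cores `floor1_bounds` (axis-1 floors under `c₁·A·(40kq·Δ) = r₁·D`) and `habX_core` (`2·Top − (arrLo₁ + arrHi₁) = E₁ + 2m₂R′ + 2R′ + 2L < 9.2σ`, the
# first-axis `E₁ ∈ [2P, 2P + dec₁)`)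

NON-VACUITY: value rows at the closed tuple (`EqNumL`, the two box-slot floors, `5 ≤ Kq`).
builds on p205010 (kernel theorem, internal audit signed; external expert review pending) — nothing in this file uses p205010; NOTHING is claimed about the
open node `SamePDropOfSkeletonFrm₁`.
Lane `prim-bschramm`, seat `prim-bschramm-stmt` (gen 21); helper file (`--supports stmt-CriticalPhenomena-4575 --as helper`).
[cite: KozmaNitzan2024, §4 Lemma 12 (pp. 23–25)] [cite: MartineauTassion2017, §4.3 Lemma 4.2]
-/

open scoped Classical

noncomputable section

namespace Summit.CriticalPhenomena.PercolationContinuityZ3.Theorems.Transplant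

namespace PlanarSkeletonFrm

namespace NegB

open Literature.Probability.Percolation Literature.Probability.LatticeModels SimpleGraph
open Literature.Probability.Percolation.KozmaNitzan.Cells (oth)
open SkelConc (Consts)
open Skelφ (shearUnit kgSL kgM₁ kgM₂ kgE₁ kgA₁ kgCtr2 kgDec₁ kgP rdLo rdHi KGRows)
open TwoAxis.Para (modulus)
open Neg

/-! ## §1 The pure-integer cores -/

/-- **Axis-1 floors**: `Δ·F ≤ s₁·X < Δ·(F+1)` for `F = ⌊c₁·(A·X)/D⌋` under the scale row `c₁·A·(40kq·Δ) = r₁·D`, `r₁ = 40kq·s₁`. [folklore] -/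
theorem floor1_bounds {c₁ A D Δ kq r₁ s₁ X F : ℤ} (hD : 0 < D) (hkq : 1 ≤ kq) (hΔ : 0 < Δ)
    (e1 : c₁ * A * (40 * kq * Δ) = r₁ * D) (hr : r₁ = 40 * kq * s₁)
    (hF : D * F ≤ c₁ * (A * X)) (hF' : c₁ * (A * X) < D * F + D) :
    Δ * F ≤ s₁ * X ∧ s₁ * X < Δ * (F + 1) := by
  have hF'' : c₁ * (A * X) < D * (F + 1) := by linarith
  have h40 : (0 : ℤ) < 40 * kq := by linarith
  have hq : 0 < 40 * kq * D := by positivity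
  have key : (40 * kq * Δ) * (c₁ * (A * X)) = (40 * kq * D) * (s₁ * X) := by
    have : (40 * kq * Δ) * (c₁ * (A * X)) = (c₁ * A * (40 * kq * Δ)) * X := by ring
    rw [this, e1, hr]; ring
  have h1 : (40 * kq * Δ) * (D * F) ≤ (40 * kq * Δ) * (c₁ * (A * X)) := mul_le_mul_of_nonneg_left hF (by positivity)
  have h2 : (40 * kq * Δ) * (c₁ * (A * X)) < (40 * kq * Δ) * (D * (F + 1)) := mul_lt_mul_of_pos_left hF'' (by positivity)
  rw [key] at h1 h2
  have e2 : (40 * kq * Δ) * (D * F) = (40 * kq * D) * (Δ * F) := by ring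
  have e3 : (40 * kq * Δ) * (D * (F + 1)) = (40 * kq * D) * (Δ * (F + 1)) := by ring
  rw [e2] at h1; rw [e3] at h2
  exact ⟨le_of_mul_le_mul_left h1 hq, lt_of_mul_lt_mul_left h2 hq.le⟩

/-- **The pure-integer x HABITAT core**: the phase boxes' row top (`Top = A₁ + (m₁+1)R′ + m₂R′ + R′ + L`, `L ≤ 3P₀ + 3`, `E₁ < 2P + (σ − 2R′)`,
`arrLo₁ + arrHi₁ = 2(A₁ + (m₁+1)R′) − E₁`, `m₂ + 1 ≤ 500`, `8000R′ ≤ σ + 1`) reads at most `5·s₁ + 1` fine cells above the creep `⌊(LO₁ + HI₁)/2⌋`. [this work] -/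
theorem habX_core {U Δ s s₁ R P₀ E₁ m₂ L A₁ a₁R Top lo₁ hi₁ FT Fl Fh : ℤ}
    (hU : 1 ≤ U) (hUs : U * s ≤ Δ) (hs : 958 ≤ s) (hs1 : 1 ≤ s₁) (hR0 : 0 ≤ R) (hR : 8000 * R ≤ s + 1) (hP1 : P₀ ≤ s + 1)
    (hE1 : E₁ < 2 * (P₀ + 1) + (s - 2 * R)) (hm2 : m₂ + 1 ≤ 500) (hL : L ≤ 3 * P₀ + 3)
    (hTop : Top = A₁ + a₁R + m₂ * R + R + L) (hC : lo₁ + hi₁ = 2 * (A₁ + a₁R) - E₁)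
    (hFT : Δ * FT ≤ s₁ * (U * Top + U - 1)) (hFl : s₁ * (U * lo₁) < Δ * (Fl + 1)) (hFh : s₁ * (U * hi₁ + U - 1) < Δ * (Fh + 1)) :
    FT + 1 ≤ (Fl + (Fh + 1)) / 2 + 5 * s₁ + 1 := by
  have hΔ : 0 < Δ := by nlinarith
  have hgap : U * (2 * Top - (lo₁ + hi₁)) + U - 1 ≤ 9 * Δ + 998 * (U * R) + 17 * U := by
    have e : 2 * Top - (lo₁ + hi₁) = E₁ + 2 * (m₂ * R) + 2 * R + 2 * L := by rw [hTop, hC]; ring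
    rw [e]
    have hmR : m₂ * R ≤ 499 * R := mul_le_mul_of_nonneg_right (by linarith) hR0
    have h1 : E₁ + 2 * (m₂ * R) + 2 * R + 2 * L ≤ 9 * s + 998 * R + 16 := by linarith
    have h2 := mul_le_mul_of_nonneg_left h1 (show (0 : ℤ) ≤ U by linarith)
    have e2 : U * (9 * s + 998 * R + 16) = 9 * (U * s) + 998 * (U * R) + 16 * U := by ring
    linarith
  have hUR : 8000 * (U * R) ≤ Δ + U := by
    have := mul_le_mul_of_nonneg_left hR (show (0 : ℤ) ≤ U by linarith); linarith
  have hU958 : 958 * U ≤ Δ := by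
    have := mul_le_mul_of_nonneg_left hs (show (0 : ℤ) ≤ U by linarith); linarith
  -- `2·FT − Fl − Fh ≤ 10·s₁ + 1`
  have key : Δ * (2 * FT - Fl - Fh) < Δ * (10 * s₁ + 2) := by
    have e1 : Δ * (2 * FT - Fl - Fh) = 2 * (Δ * FT) - Δ * (Fl + 1) - Δ * (Fh + 1) + 2 * Δ := by ring
    have e2 : 2 * (s₁ * (U * Top + U - 1)) - s₁ * (U * lo₁) - s₁ * (U * hi₁ + U - 1) = s₁ * (U * (2 * Top - (lo₁ + hi₁)) + U - 1) := by ring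
    have h3 : s₁ * (U * (2 * Top - (lo₁ + hi₁)) + U - 1) ≤ s₁ * (9 * Δ + 998 * (U * R) + 17 * U) := mul_le_mul_of_nonneg_left hgap (by linarith)
    have h4 : s₁ * (9 * Δ + 998 * (U * R) + 17 * U) ≤ s₁ * (10 * Δ) := by
      have : 9 * Δ + 998 * (U * R) + 17 * U ≤ 10 * Δ := by linarith
      exact mul_le_mul_of_nonneg_left this (by linarith)
    have e3 : Δ * (10 * s₁ + 2) = s₁ * (10 * Δ) + 2 * Δ := by ring
    rw [e1, e3]; linarith
  have h2 : 2 * FT - Fl - Fh < 10 * s₁ + 2 := lt_of_mul_lt_mul_left key hΔ.le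
  omega

/-! ## §2 At the tuple of record -/

section HabX

variable (κ : Consts) {V : Type} [DecidableEq V] [Countable V] {G : SimpleGraph V} [G.LocallyFinite] (Φ : PlanarSkeletonFrm G) (t : V) (p : unitInterval)
  (D : Skelφ.StepI.DataNS V) (g f mk : ℕ)

/-- **THE x V HABITAT ROW, BOX FORM**: any frame box whose row top is at most the phase boxes' top reads `rdHi₁ ≤ cRvW 0 + 5·s₁ + 1`. [this work] -/
theorem habX_box_V (hKq : 5 ≤ Neg.Kq κ) (hN : EqNumL κ Φ t p D g f) (hg : gFloorKG κ Φ t p D mk ≤ g) (hg2 : 40 * Neg.K κ * KS0.R'0 κ Φ t p D mk ≤ g)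
    (lo hi : Site 2)
    (hhi : hi 1 ≤ (((kgA₁ (nL κ Φ t p D g f) (ℓL κ Φ t p D g f) (hL κ Φ t p D g f) (kgR κ Φ t p D mk) (kgW κ Φ t p D g f (WxQ4 κ Φ t p D g f)) (kgNv0 κ Φ t p D g f mk (qxQ4 κ Φ t p D g f) (WxQ4 κ Φ t p D g f)) : ℕ) : ℤ) + ((((kgM₁ (nL κ Φ t p D g f) (ℓL κ Φ t p D g f) (hL κ Φ t p D g f) (kgR κ Φ t p D mk) 0 (kgW κ Φ t p D g f (WxQ4 κ Φ t p D g f)) (kgNv0 κ Φ t p D g f mk (qxQ4 κ Φ t p D g f) (WxQ4 κ Φ t p D g f)) : ℕ) : ℤ)) + 1) * ((((kgR κ Φ t p D mk) : ℕ) : ℤ) + ((0 : ℕ) : ℤ)) +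
        (((kgM₂ (nL κ Φ t p D g f) (ℓL κ Φ t p D g f) (hL κ Φ t p D g f) (vL κ Φ t p D g f) (kgR κ Φ t p D mk) 0 (kgq κ Φ t p D g f (qxQ4 κ Φ t p D g f)) (kgW κ Φ t p D g f (WxQ4 κ Φ t p D g f)) (kgNv0 κ Φ t p D g f mk (qxQ4 κ Φ t p D g f) (WxQ4 κ Φ t p D g f)) : ℕ) : ℤ)) * ((((kgR κ Φ t p D mk) : ℕ) : ℤ) + ((0 : ℕ) : ℤ)) + (((kgR κ Φ t p D mk) : ℕ) : ℤ) + ((3 * ((nL κ Φ t p D g f) * (ℓL κ Φ t p D g f)) / (shearUnit (nL κ Φ t p D g f) (hL κ Φ t p D g f)) + 1 : ℕ) : ℤ))) :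
    rdHi (Aof κ) (nL κ Φ t p D g f) (hL κ Φ t p D g f) (vL κ Φ t p D g f) (vβL κ Φ t p D g f) (prFA κ Φ t p D g f).c₀ (prFA κ Φ t p D g f).c₁ (prFA κ Φ t p D g f).D lo hi 1 ≤ ((cRvW κ Φ t p D g f mk 0 : ℕ) : ℤ) + 5 * (((fcellsA κ Φ t p D g f).s 1 : ℕ) : ℤ) + 1 := by
  obtain ⟨-, hsc1, hn1, hA0, hDp, hm, -, -, hkq, -⟩ := hsc_Q κ Φ t p D g f hN
  obtain ⟨hnR', hs40, hbig, hR1, -, -⟩ := valsQ_floor κ Φ t p D g f mk hN hg hg2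
  have hUs := UsL_le_modulus κ Φ t p D g f hN
  have hU1 : (1 : ℤ) ≤ (((shearUnit (nL κ Φ t p D g f) (hL κ Φ t p D g f)) : ℕ) : ℤ) := by exact_mod_cast Skelφ.shearUnit_pos hn1 (hL κ Φ t p D g f)
  have hUpos : 0 < (shearUnit (nL κ Φ t p D g f) (hL κ Φ t p D g f)) := by
    have := Skelφ.shearUnit_pos hn1 (hL κ Φ t p D g f)
    exact_mod_cast this
  have H := kgRows0_of κ Φ t p D g f mk (qxQ4 κ Φ t p D g f) (WxQ4 κ Φ t p D g f) hN hg
  have hE := (H.kgE₁_spec (kgNv0 κ Φ t p D g f mk (qxQ4 κ Φ t p D g f) (WxQ4 κ Φ t p D g f))).2.2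
  have hm2 := m₂Q4_le κ Φ t p D g f mk hN hg hg2
  have h3L : ((3 * ((nL κ Φ t p D g f) * (ℓL κ Φ t p D g f)) / (shearUnit (nL κ Φ t p D g f) (hL κ Φ t p D g f)) : ℕ) : ℤ) ≤ ((3 * ((nL κ Φ t p D g f) * (ℓL κ Φ t p D g f) / (shearUnit (nL κ Φ t p D g f) (hL κ Φ t p D g f))) + 2 : ℕ) : ℤ) := by
    exact_mod_cast Skelφ.natDiv_three_le ((nL κ Φ t p D g f) * (ℓL κ Φ t p D g f)) (shearUnit (nL κ Φ t p D g f) (hL κ Φ t p D g f)) hUpos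
  have hP1 : (((nL κ Φ t p D g f) : ℕ) : ℤ) * (ℓL κ Φ t p D g f) / ((shearUnit (nL κ Φ t p D g f) (hL κ Φ t p D g f)) : ℕ) ≤ kgSL (nL κ Φ t p D g f) (ℓL κ Φ t p D g f) (hL κ Φ t p D g f) + 1 := by
    have := Skelφ.natDiv_le_kgSLY hn1 (ℓL κ Φ t p D g f) (hL κ Φ t p D g f)
    have hP0nat : (((nL κ Φ t p D g f) * (ℓL κ Φ t p D g f) / (shearUnit (nL κ Φ t p D g f) (hL κ Φ t p D g f)) : ℕ) : ℤ) = (((nL κ Φ t p D g f) : ℕ) : ℤ) * (ℓL κ Φ t p D g f) / ((shearUnit (nL κ Φ t p D g f) (hL κ Φ t p D g f)) : ℕ) := by push_cast; rfl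
    rw [hP0nat, kgSLY_eq_kgSL] at this; exact this
  obtain ⟨hsum, -, -, -⟩ := arr1_sum_eq_W κ Φ t p D g f mk hN hg
  -- `K ≥ 200`, `r₁ = 40kq·s₁`, `8000R′ ≤ sL + 1`
  have hKq40 : (Neg.K κ : ℤ) = 40 * ((Neg.Kq κ : ℕ) : ℤ) := by exact_mod_cast Neg.K_eq κ
  have hkq5 : (5 : ℤ) ≤ ((Neg.Kq κ : ℕ) : ℤ) := by exact_mod_cast hKq
  have hr1 : (((fcellsA κ Φ t p D g f).r 1 : ℕ) : ℤ) = 40 * ((Neg.Kq κ : ℕ) : ℤ) * (((fcellsA κ Φ t p D g f).s 1 : ℕ) : ℤ) := by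
    rw [PCells2.r_eq, show ((fcellsA κ Φ t p D g f).K : ℤ) = Neg.K κ by exact_mod_cast (fcellsA_K κ Φ t p D g f).1, hKq40]
  have hs1 : (1 : ℤ) ≤ (((fcellsA κ Φ t p D g f).s 1 : ℕ) : ℤ) := by exact_mod_cast (fcellsA κ Φ t p D g f).hs 1
  have hRR : ((KS0.R'0 κ Φ t p D mk : ℕ) : ℤ) = (((kgR κ Φ t p D mk) : ℕ) : ℤ) := rfl
  rw [hRR] at hs40 hR1
  have hR0 : (0 : ℤ) ≤ (((kgR κ Φ t p D mk) : ℕ) : ℤ) := by linarith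
  have hR8000 : 8000 * (((kgR κ Φ t p D mk) : ℕ) : ℤ) ≤ kgSL (nL κ Φ t p D g f) (ℓL κ Φ t p D g f) (hL κ Φ t p D g f) + 1 := by
    have h1 : 200 * (((kgR κ Φ t p D mk) : ℕ) : ℤ) ≤ (Neg.K κ : ℤ) * (((kgR κ Φ t p D mk) : ℕ) : ℤ) := mul_le_mul_of_nonneg_right (by linarith) hR0
    have e : (40 : ℤ) * (Neg.K κ : ℤ) * (((kgR κ Φ t p D mk) : ℕ) : ℤ) = 40 * ((Neg.K κ : ℤ) * (((kgR κ Φ t p D mk) : ℕ) : ℤ)) := by ring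
    rw [e] at hs40; linarith
  have hkq1 : (1 : ℤ) ≤ ((Neg.Kq κ : ℕ) : ℤ) := by linarith
  -- the creep as the midpoint, the readings as floors
  obtain ⟨hc, -⟩ := cRvW_zero_eq κ Φ t p D g f mk hN hg hg2
  rw [hc]
  unfold cmidW
  simp only [Skelφ.rdLo_one, Skelφ.rdHi_one]
  set Xl := ((((shearUnit (nL κ Φ t p D g f) (hL κ Φ t p D g f)) : ℕ) : ℤ) * arrLoQ3 κ Φ t p D g f mk 1) with hXl
  set Xh := ((((shearUnit (nL κ Φ t p D g f) (hL κ Φ t p D g f)) : ℕ) : ℤ) * arrHiQ3 κ Φ t p D g f mk 1 + ((shearUnit (nL κ Φ t p D g f) (hL κ Φ t p D g f)) : ℕ) - 1) with hXh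
  set XT := ((((shearUnit (nL κ Φ t p D g f) (hL κ Φ t p D g f)) : ℕ) : ℤ) * hi 1 + ((shearUnit (nL κ Φ t p D g f) (hL κ Φ t p D g f)) : ℕ) - 1) with hXT
  have hFl := Int.mul_ediv_self_le (x := (prFA κ Φ t p D g f).c₁ * (Aof κ * Xl)) (ne_of_gt hDp)
  have hFl' := Int.lt_mul_ediv_self_add (x := (prFA κ Φ t p D g f).c₁ * (Aof κ * Xl)) hDp
  have hFh := Int.mul_ediv_self_le (x := (prFA κ Φ t p D g f).c₁ * (Aof κ * Xh)) (ne_of_gt hDp)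
  have hFh' := Int.lt_mul_ediv_self_add (x := (prFA κ Φ t p D g f).c₁ * (Aof κ * Xh)) hDp
  have hFT := Int.mul_ediv_self_le (x := (prFA κ Φ t p D g f).c₁ * (Aof κ * XT)) (ne_of_gt hDp)
  have hFT' := Int.lt_mul_ediv_self_add (x := (prFA κ Φ t p D g f).c₁ * (Aof κ * XT)) hDp
  obtain ⟨-, h1⟩ := floor1_bounds hDp hkq1 hm hsc1 hr1 hFl hFl'
  obtain ⟨-, h2⟩ := floor1_bounds hDp hkq1 hm hsc1 hr1 hFh hFh'
  obtain ⟨h3, -⟩ := floor1_bounds hDp hkq1 hm hsc1 hr1 hFT hFT'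
  -- `s₁·X_T(hi 1) ≤ s₁·X_T(Top)`
  have hmono : (((fcellsA κ Φ t p D g f).s 1 : ℕ) : ℤ) * XT ≤ (((fcellsA κ Φ t p D g f).s 1 : ℕ) : ℤ) *
      ((((shearUnit (nL κ Φ t p D g f) (hL κ Φ t p D g f)) : ℕ) : ℤ) * ((((kgA₁ (nL κ Φ t p D g f) (ℓL κ Φ t p D g f) (hL κ Φ t p D g f) (kgR κ Φ t p D mk) (kgW κ Φ t p D g f (WxQ4 κ Φ t p D g f)) (kgNv0 κ Φ t p D g f mk (qxQ4 κ Φ t p D g f) (WxQ4 κ Φ t p D g f)) : ℕ) : ℤ) + ((((kgM₁ (nL κ Φ t p D g f) (ℓL κ Φ t p D g f) (hL κ Φ t p D g f) (kgR κ Φ t p D mk) 0 (kgW κ Φ t p D g f (WxQ4 κ Φ t p D g f)) (kgNv0 κ Φ t p D g f mk (qxQ4 κ Φ t p D g f) (WxQ4 κ Φ t p D g f)) : ℕ) : ℤ)) + 1) * ((((kgR κ Φ t p D mk) : ℕ) : ℤ) + ((0 : ℕ) : ℤ)) +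
        (((kgM₂ (nL κ Φ t p D g f) (ℓL κ Φ t p D g f) (hL κ Φ t p D g f) (vL κ Φ t p D g f) (kgR κ Φ t p D mk) 0 (kgq κ Φ t p D g f (qxQ4 κ Φ t p D g f)) (kgW κ Φ t p D g f (WxQ4 κ Φ t p D g f)) (kgNv0 κ Φ t p D g f mk (qxQ4 κ Φ t p D g f) (WxQ4 κ Φ t p D g f)) : ℕ) : ℤ)) * ((((kgR κ Φ t p D mk) : ℕ) : ℤ) + ((0 : ℕ) : ℤ)) + (((kgR κ Φ t p D mk) : ℕ) : ℤ) + ((3 * ((nL κ Φ t p D g f) * (ℓL κ Φ t p D g f)) / (shearUnit (nL κ Φ t p D g f) (hL κ Φ t p D g f)) + 1 : ℕ) : ℤ))) + ((shearUnit (nL κ Φ t p D g f) (hL κ Φ t p D g f)) : ℕ) - 1) := by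
    refine mul_le_mul_of_nonneg_left ?_ (by linarith)
    have := mul_le_mul_of_nonneg_left hhi (show (0 : ℤ) ≤ (((shearUnit (nL κ Φ t p D g f) (hL κ Φ t p D g f)) : ℕ) : ℤ) by linarith)
    rw [hXT]; linarith
  have hE' : ((kgE₁ (nL κ Φ t p D g f) (ℓL κ Φ t p D g f) (hL κ Φ t p D g f) (kgR κ Φ t p D mk) 0 (kgW κ Φ t p D g f (WxQ4 κ Φ t p D g f)) (kgNv0 κ Φ t p D g f mk (qxQ4 κ Φ t p D g f) (WxQ4 κ Φ t p D g f)) : ℕ) : ℤ) < 2 * ((((nL κ Φ t p D g f) : ℕ) : ℤ) * (ℓL κ Φ t p D g f) / ((shearUnit (nL κ Φ t p D g f) (hL κ Φ t p D g f)) : ℕ) + 1) + (kgSL (nL κ Φ t p D g f) (ℓL κ Φ t p D g f) (hL κ Φ t p D g f) - 2 * (((kgR κ Φ t p D mk) : ℕ) : ℤ)) := by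
    have e : kgDec₁ (nL κ Φ t p D g f) (ℓL κ Φ t p D g f) (hL κ Φ t p D g f) (kgR κ Φ t p D mk) 0 = kgSL (nL κ Φ t p D g f) (ℓL κ Φ t p D g f) (hL κ Φ t p D g f) - 2 * (((kgR κ Φ t p D mk) : ℕ) : ℤ) - ((0 : ℕ) : ℤ) := rfl
    unfold Skelφ.kgP at hE; rw [e] at hE; push_cast at hE ⊢; linarith
  have hsum' : arrLoQ3 κ Φ t p D g f mk 1 + arrHiQ3 κ Φ t p D g f mk 1 =
      2 * (((kgA₁ (nL κ Φ t p D g f) (ℓL κ Φ t p D g f) (hL κ Φ t p D g f) (kgR κ Φ t p D mk) (kgW κ Φ t p D g f (WxQ4 κ Φ t p D g f)) (kgNv0 κ Φ t p D g f mk (qxQ4 κ Φ t p D g f) (WxQ4 κ Φ t p D g f)) : ℕ) : ℤ) + ((((kgM₁ (nL κ Φ t p D g f) (ℓL κ Φ t p D g f) (hL κ Φ t p D g f) (kgR κ Φ t p D mk) 0 (kgW κ Φ t p D g f (WxQ4 κ Φ t p D g f)) (kgNv0 κ Φ t p D g f mk (qxQ4 κ Φ t p D g f) (WxQ4 κ Φ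 t p D g f)) : ℕ) : ℤ)) + 1) * ((((kgR κ Φ t p D mk) : ℕ) : ℤ) + ((0 : ℕ) : ℤ))) -
        ((kgE₁ (nL κ Φ t p D g f) (ℓL κ Φ t p D g f) (hL κ Φ t p D g f) (kgR κ Φ t p D mk) 0 (kgW κ Φ t p D g f (WxQ4 κ Φ t p D g f)) (kgNv0 κ Φ t p D g f mk (qxQ4 κ Φ t p D g f) (WxQ4 κ Φ t p D g f)) : ℕ) : ℤ) := by
    rw [hsum]; unfold Skelφ.kgCtr2; push_cast; ring
  exact habX_core (E₁ := ((kgE₁ (nL κ Φ t p D g f) (ℓL κ Φ t p D g f) (hL κ Φ t p D g f) (kgR κ Φ t p D mk) 0 (kgW κ Φ t p D g f (WxQ4 κ Φ t p D g f)) (kgNv0 κ Φ t p D g f mk (qxQ4 κ Φ t p D g f) (WxQ4 κ Φ t p D g f)) : ℕ) : ℤ))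
    (m₂ := (((kgM₂ (nL κ Φ t p D g f) (ℓL κ Φ t p D g f) (hL κ Φ t p D g f) (vL κ Φ t p D g f) (kgR κ Φ t p D mk) 0 (kgq κ Φ t p D g f (qxQ4 κ Φ t p D g f)) (kgW κ Φ t p D g f (WxQ4 κ Φ t p D g f)) (kgNv0 κ Φ t p D g f mk (qxQ4 κ Φ t p D g f) (WxQ4 κ Φ t p D g f)) : ℕ) : ℤ)))
    (L := ((3 * ((nL κ Φ t p D g f) * (ℓL κ Φ t p D g f)) / (shearUnit (nL κ Φ t p D g f) (hL κ Φ t p D g f)) + 1 : ℕ) : ℤ)) (A₁ := ((kgA₁ (nL κ Φ t p D g f) (ℓL κ Φ t p D g f) (hL κ Φ t p D g f) (kgR κ Φ t p D mk) (kgW κ Φ t p D g f (WxQ4 κ Φ t p D g f)) (kgNv0 κ Φ t p D g f mk (qxQ4 κ Φ t p D g f) (WxQ4 κ Φ t p D g f)) : ℕ) : ℤ))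
    (a₁R := ((((kgM₁ (nL κ Φ t p D g f) (ℓL κ Φ t p D g f) (hL κ Φ t p D g f) (kgR κ Φ t p D mk) 0 (kgW κ Φ t p D g f (WxQ4 κ Φ t p D g f)) (kgNv0 κ Φ t p D g f mk (qxQ4 κ Φ t p D g f) (WxQ4 κ Φ t p D g f)) : ℕ) : ℤ)) + 1) * ((((kgR κ Φ t p D mk) : ℕ) : ℤ) + ((0 : ℕ) : ℤ)))
    (Top := (((kgA₁ (nL κ Φ t p D g f) (ℓL κ Φ t p D g f) (hL κ Φ t p D g f) (kgR κ Φ t p D mk) (kgW κ Φ t p D g f (WxQ4 κ Φ t p D g f)) (kgNv0 κ Φ t p D g f mk (qxQ4 κ Φ t p D g f) (WxQ4 κ Φ t p D g f)) : ℕ) : ℤ) + ((((kgM₁ (nL κ Φ t p D g f) (ℓL κ Φ t p D g f) (hL κ Φ t p D g f) (kgR κ Φ t p D mk) 0 (kgW κ Φ t p D g f (WxQ4 κ Φ t p D g f)) (kgNv0 κ Φ t p D g f mk (qxQ4 κ Φ t p D g f) (WxQ4 κ Φ t p D g f)) : ℕ) : ℤ)) + 1) * ((((kgR κ Φ t p D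 mk) : ℕ) : ℤ) + ((0 : ℕ) : ℤ)) +
        (((kgM₂ (nL κ Φ t p D g f) (ℓL κ Φ t p D g f) (hL κ Φ t p D g f) (vL κ Φ t p D g f) (kgR κ Φ t p D mk) 0 (kgq κ Φ t p D g f (qxQ4 κ Φ t p D g f)) (kgW κ Φ t p D g f (WxQ4 κ Φ t p D g f)) (kgNv0 κ Φ t p D g f mk (qxQ4 κ Φ t p D g f) (WxQ4 κ Φ t p D g f)) : ℕ) : ℤ)) * ((((kgR κ Φ t p D mk) : ℕ) : ℤ) + ((0 : ℕ) : ℤ)) + (((kgR κ Φ t p D mk) : ℕ) : ℤ) + ((3 * ((nL κ Φ t p D g f) * (ℓL κ Φ t p D g f)) / (shearUnit (nL κ Φ t p D g f) (hL κ Φ t p D g f)) + 1 : ℕ) : ℤ)))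
    (hU := hU1) (hUs := hUs) (hs := hbig) (hs1 := hs1) (hR0 := hR0) (hR := hR8000) (hP1 := hP1) (hE1 := hE')
    (hm2 := by linarith [hm2]) (hL := by push_cast at h3L ⊢; linarith) (hTop := by push_cast; ring) (hC := hsum')
    (hFT := le_trans h3 hmono) (hFl := h1) (hFh := h2)

end HabX

end NegB

end PlanarSkeletonFrm

end Summit.CriticalPhenomena.PercolationContinuityZ3.Theorems.Transplant

end
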